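import Summits.CriticalPhenomena.PercolationContinuityZ3.Theorems.PercNearOneGluingNoHeavyLowerTailAntipodalR1OneSumApex
import HarnessLib

/-!
# ANTI₁ across a cut vertex: a terminal block

Support file for `stmt-CriticalPhenomena-4575` (memo `prim-gen-kcluster/KCLUSTER-gen73.md` §1.8 (C);
conjecture ANTI₁ of `KCLUSTER-gen52.md` §3).  No definitions, no named facts, no sorries.  Vocabulary of
`AntipodalR1` (`clus`, `freeNbr`, `region`, `lSet`, `rSet`; gen 62), the cut-vertex cluster lemmas of
`…AntipodalR1OneSumApex` and the counting lemmas of `…AntipodalR1TwoCut` (gen 78).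

Setting.  `G = N ∪ F` glued at ONE vertex `u` (`Sum.elim endsN endsF`, every vertex met by edges of
both sides equal to `u`); the apex `a` and the terminal `b` lie on the near side `N` (met by edges of
`F` only if equal to `u`), the terminal `c` is interior to the far side `F` (met by an edge of `F`,
`c ≠ u`).

**Theorem** (`card_lSet_le_card_rSet_of_terminalBlock`, the 1-sum reduction (C) of the memo):
ANTI₁ for `(N; a, b, u)` implies ANTI₁ for `(G; a, b, c)`.  The memo's identity is
`L(G) = M × X ⊔ L(N; a, b, u) × Y`, `R(G) ⊇ M × σX ⊔ R(N; a, b, u) × σY` with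
`M = {b ∈ O_a ∖ K_a, u ∈ O_a ∩ K_a on N}`, `X = {c ∈ O_u ∖ K_u on F}`, `Y = {c ∈ O_u on F}`, `σ` the
colour swap on `F`; we prove the resulting inequality fibrewise over the colouring `ω_F` of `F`, pairing
`ω_F` with `σ ω_F` (`fibre_le_terminalBlock`).  Together with `…TwoCutCutVertex` (case (A)) and
`…OneSumApex` (case (B)) this is the kernel form of "ANTI₁ reduces over 1-sums" except for the
degenerate placements `u = a` with `b, c` in different blocks and `u ∈ {b, c}` (memo §1.8 (D)).
[this work]
-/

namespace Summit.CriticalPhenomena.PercolationContinuityZ3.Theorems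

namespace AntipodalR1

open Finset Relation

variable {V ιN ιF : Type*}

section Paths

variable {endsN : ιN → Sym2 V} {endsF : ιF → Sym2 V} {u a b : V} {ω : ιN ⊕ ιF → Bool}

/-- A support path of the near side from `b` avoiding `K_a(N)` is a support path of `G` avoiding
`K_a(G)` (for `b` on the near side). [this work] -/
theorem region_of_near
    (hsep : ∀ w i, w ∈ endsN i → ∀ j, w ∈ endsF j → w = u) (ha : ∀ j, a ∈ endsF j → a = u)
    (hb : ∀ j, b ∈ endsF j → b = u) {x : V} (hx : x ∈ region endsN (fun i => ω (Sum.inl i)) a b) :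
    x ∈ region (Sum.elim endsN endsF) ω a b := by
  rw [mem_region] at hx ⊢
  suffices h : (∀ j, x ∈ endsF j → x = u) ∧
      ReflTransGen (fun p q => q ∈ freeNbr (Sum.elim endsN endsF) ω a p) b x from h.2
  induction hx with
  | refl => exact ⟨hb, ReflTransGen.refl⟩
  | @tail y z _ hyz ih =>
    obtain ⟨⟨i, he⟩, hyK, hzK⟩ := hyz
    have hzN : ∀ j, z ∈ endsF j → z = u := hsep z i (by rw [he]; exact Sym2.mem_mk_right _ _)
    exact ⟨hzN, ih.2.tail ⟨⟨Sum.inl i, he⟩,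
      fun h => hyK ((mem_clus_iff_of_cutVertex hsep ha ih.1).1 h),
      fun h => hzK ((mem_clus_iff_of_cutVertex hsep ha hzN).1 h)⟩⟩

/-- Along a support path of `G` from `b` avoiding `K_a(G)`: a near-side vertex is reached inside `N`
avoiding `K_a(N)`, and once the path has entered the interior of `F` it has passed through `u`, so
`u` is reached inside `N` avoiding `K_a(N)`. [this work] -/
theorem region_near_of_region
    (hsep : ∀ w i, w ∈ endsN i → ∀ j, w ∈ endsF j → w = u) (ha : ∀ j, a ∈ endsF j → a = u)
    (hb : ∀ j, b ∈ endsF j → b = u) {x : V} (hx : x ∈ region (Sum.elim endsN endsF) ω a b) :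
    ((∀ j, x ∈ endsF j → x = u) → x ∈ region endsN (fun i => ω (Sum.inl i)) a b) ∧
    (¬ (∀ j, x ∈ endsF j → x = u) → u ∈ region endsN (fun i => ω (Sum.inl i)) a b) := by
  rw [mem_region] at hx
  rw [mem_region, mem_region]
  induction hx with
  | refl => exact ⟨fun _ => ReflTransGen.refl, fun h => (h hb).elim⟩
  | @tail y z _ hyz ih =>
    obtain ⟨⟨e, he⟩, hyK, hzK⟩ := hyz
    cases e with
    | inl i =>
      have he' : endsN i = s(y, z) := he
      have hyN : ∀ j, y ∈ endsF j → y = u := hsep y i (by rw [he']; exact Sym2.mem_mk_left _ _)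
      have hzN : ∀ j, z ∈ endsF j → z = u := hsep z i (by rw [he']; exact Sym2.mem_mk_right _ _)
      refine ⟨fun _ => (ih.1 hyN).tail ⟨⟨i, he'⟩, ?_, ?_⟩, fun h => (h hzN).elim⟩
      · exact fun h => hyK ((mem_clus_iff_of_cutVertex hsep ha hyN).2 h)
      · exact fun h => hzK ((mem_clus_iff_of_cutVertex hsep ha hzN).2 h)
    | inr j =>
      have he' : endsF j = s(y, z) := he
      have hyj : y ∈ endsF j := by rw [he']; exact Sym2.mem_mk_left _ _
      have hzj : z ∈ endsF j := by rw [he']; exact Sym2.mem_mk_right _ _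
      -- the path is at `u` (if `y` is on the near side) or already past it
      have hu : ReflTransGen (fun p q => q ∈ freeNbr endsN (fun i => ω (Sum.inl i)) a p) b u := by
        by_cases hyN : ∀ j, y ∈ endsF j → y = u
        · exact hyN j hyj ▸ ih.1 hyN
        · exact ih.2 hyN
      exact ⟨fun hzN => hzN j hzj ▸ hu, fun _ => hu⟩

end Paths

section Sets

variable {endsN : ιN → Sym2 V} {endsF : ιF → Sym2 V} {u a b c : V}
variable [Fintype ιN] [DecidableEq ιN] [Fintype ιF] [DecidableEq ιF]

/-- **Anatomy of `L(G)`.**  For `ω_N ⊕ ω_F ∈ L(G; a, b, c)` (with `a, b` near, `c` interior to `F`):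
`b ∈ O_a ∖ K_a` on `N`, `u ∈ O_a(N)`, `c ∈ O_u(F)`, and EITHER `u ∈ K_a(N)` and `c ∉ K_u(F)`, OR
`u ∉ K_a(N)` and `ω_N ∈ L(N; a, b, u)`. [this work] -/
theorem mem_lSet_terminalBlock
    (hsep : ∀ w i, w ∈ endsN i → ∀ j, w ∈ endsF j → w = u) (ha : ∀ j, a ∈ endsF j → a = u)
    (hb : ∀ j, b ∈ endsF j → b = u) (hcF : ∃ j, c ∈ endsF j) (hcu : c ≠ u)
    {ωN : ιN → Bool} {ωF : ιF → Bool} (h : Sum.elim ωN ωF ∈ lSet (Sum.elim endsN endsF) a b c) :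
    b ∈ clus endsN ωN true a ∧ b ∉ clus endsN ωN false a ∧ u ∈ clus endsN ωN true a ∧
      c ∈ clus endsF ωF true u ∧
      ((u ∈ clus endsN ωN false a ∧ c ∉ clus endsF ωF false u) ∨
        (u ∉ clus endsN ωN false a ∧ ωN ∈ lSet endsN a b u)) := by
  classical
  obtain ⟨hOb, hKb, hOc, hKc, hbc⟩ := (mem_filter.1 h).2
  have hOb' : b ∈ clus endsN ωN true a := (mem_clus_iff_of_cutVertex hsep ha hb).1 hOb
  have hKb' : b ∉ clus endsN ωN false a :=
    fun h' => hKb ((mem_clus_iff_of_cutVertex (ω := Sum.elim ωN ωF) hsep ha hb).2 h')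
  have hOc' := (mem_clus_iff_of_interior (ω := Sum.elim ωN ωF) hsep ha hcF hcu).1 hOc
  refine ⟨hOb', hKb', hOc'.1, hOc'.2, ?_⟩
  by_cases huK : u ∈ clus endsN ωN false a
  · exact Or.inl ⟨huK, fun h' => hKc
      ((mem_clus_iff_of_interior (ω := Sum.elim ωN ωF) hsep ha hcF hcu).2 ⟨huK, h'⟩)⟩
  · refine Or.inr ⟨huK, mem_filter.2 ⟨mem_univ _, hOb', hKb', hOc'.1, huK, fun hub => hbc ?_⟩⟩
    -- `u ∈ region_N(b)` and `c ∈ O_u(F)` with `u ∉ K_a(N)` join `b` to `c` avoiding `K_a(G)`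
    rw [mem_region]
    exact (mem_region.1 (region_of_near (ω := Sum.elim ωN ωF) hsep ha hb hub)).trans
      (freePath_of_clusT (ω := Sum.elim ωN ωF) hsep ha huK hcF hOc'.2)

/-- **`R(G) ⊇ M × σX`.**  If `b ∈ O_a ∖ K_a` and `u ∈ K_a` on `N`, and `c ∈ K_u ∖ O_u` on `F`, then
`ω_N ⊕ ω_F ∈ R(G; a, b, c)`. [this work] -/
theorem mem_rSet_terminalBlock_of_M
    (hsep : ∀ w i, w ∈ endsN i → ∀ j, w ∈ endsF j → w = u) (ha : ∀ j, a ∈ endsF j → a = u)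
    (hb : ∀ j, b ∈ endsF j → b = u) (hcF : ∃ j, c ∈ endsF j) (hcu : c ≠ u)
    {ωN : ιN → Bool} {ωF : ιF → Bool} (hOb : b ∈ clus endsN ωN true a)
    (hKb : b ∉ clus endsN ωN false a) (huK : u ∈ clus endsN ωN false a)
    (hcK : c ∈ clus endsF ωF false u) (hcO : c ∉ clus endsF ωF true u) :
    Sum.elim ωN ωF ∈ rSet (Sum.elim endsN endsF) a b c := by
  classical
  exact mem_filter.2 ⟨mem_univ _, (mem_clus_iff_of_cutVertex (ω := Sum.elim ωN ωF) hsep ha hb).2 hOb,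
    fun h => hKb ((mem_clus_iff_of_cutVertex (ω := Sum.elim ωN ωF) hsep ha hb).1 h),
    (mem_clus_iff_of_interior (ω := Sum.elim ωN ωF) hsep ha hcF hcu).2 ⟨huK, hcK⟩,
    fun h => hcO ((mem_clus_iff_of_interior (ω := Sum.elim ωN ωF) hsep ha hcF hcu).1 h).2⟩

/-- **`R(G) ⊇ R(N; a, b, u) × σY`.**  If `ω_N ∈ R(N; a, b, u)` and `c ∈ K_u` on `F`, then
`ω_N ⊕ ω_F ∈ R(G; a, b, c)`. [this work] -/
theorem mem_rSet_terminalBlock_of_rSet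
    (hsep : ∀ w i, w ∈ endsN i → ∀ j, w ∈ endsF j → w = u) (ha : ∀ j, a ∈ endsF j → a = u)
    (hb : ∀ j, b ∈ endsF j → b = u) (hcF : ∃ j, c ∈ endsF j) (hcu : c ≠ u)
    {ωN : ιN → Bool} {ωF : ιF → Bool} (hN : ωN ∈ rSet endsN a b u)
    (hcK : c ∈ clus endsF ωF false u) :
    Sum.elim ωN ωF ∈ rSet (Sum.elim endsN endsF) a b c := by
  classical
  obtain ⟨hOb, hKb, huK, huO⟩ := (mem_filter.1 hN).2
  exact mem_filter.2 ⟨mem_univ _, (mem_clus_iff_of_cutVertex (ω := Sum.elim ωN ωF) hsep ha hb).2 hOb,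
    fun h => hKb ((mem_clus_iff_of_cutVertex (ω := Sum.elim ωN ωF) hsep ha hb).1 h),
    (mem_clus_iff_of_interior (ω := Sum.elim ωN ωF) hsep ha hcF hcu).2 ⟨huK, hcK⟩,
    fun h => huO ((mem_clus_iff_of_interior (ω := Sum.elim ωN ωF) hsep ha hcF hcu).1 h).1⟩

/-- **The paired fibre inequality.**  For every colouring `ω_F` of the far side, the `L(G)`-fibre
over `ω_F` is no larger than the `R(G)`-fibre over the colour swap `σ ω_F`. [this work] -/
theorem fibre_le_terminalBlock
    (hsep : ∀ w i, w ∈ endsN i → ∀ j, w ∈ endsF j → w = u) (ha : ∀ j, a ∈ endsF j → a = u)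
    (hb : ∀ j, b ∈ endsF j → b = u) (hcF : ∃ j, c ∈ endsF j) (hcu : c ≠ u)
    (h0 : (lSet endsN a b u).card ≤ (rSet endsN a b u).card) (ωF : ιF → Bool) :
    (univ.filter fun ωN : ιN → Bool => Sum.elim ωN ωF ∈ lSet (Sum.elim endsN endsF) a b c).card ≤
      (univ.filter fun ωN : ιN → Bool =>
        Sum.elim ωN (fun j => !ωF j) ∈ rSet (Sum.elim endsN endsF) a b c).card := by
  classical
  have hflip : ∀ col, c ∈ clus endsF (fun j => !ωF j) col u ↔ c ∈ clus endsF ωF (!col) u :=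
    fun col => mem_clus_flip endsF ωF col u c
  -- the near-side set `M = {b ∈ O_a ∖ K_a, u ∈ O_a ∩ K_a}` and its disjointness from `R(N; a, b, u)`
  have hdisj : Disjoint (univ.filter fun ωN : ιN → Bool => b ∈ clus endsN ωN true a ∧
      b ∉ clus endsN ωN false a ∧ u ∈ clus endsN ωN true a ∧ u ∈ clus endsN ωN false a)
      (rSet endsN a b u) := by
    refine disjoint_left.2 fun ωN h1 h2 => ?_
    exact (mem_filter.1 h2).2.2.2.2 (mem_filter.1 h1).2.2.2.1
  by_cases hcO : c ∈ clus endsF ωF true u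
  · by_cases hcK : c ∈ clus endsF ωF false u
    · -- `ω_F ∈ Y ∖ X`: the fibre embeds into `L(N; a, b, u)`; `R(N; a, b, u) × {σ ω_F} ⊆ R(G)`
      calc (univ.filter fun ωN : ιN → Bool =>
            Sum.elim ωN ωF ∈ lSet (Sum.elim endsN endsF) a b c).card
          ≤ (lSet endsN a b u).card := by
            refine card_le_card fun ωN h => ?_
            rcases (mem_lSet_terminalBlock hsep ha hb hcF hcu (mem_filter.1 h).2).2.2.2.2 with
              ⟨-, h'⟩ | ⟨-, h'⟩
            · exact (h' hcK).elim
            · exact h'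
        _ ≤ (rSet endsN a b u).card := h0
        _ ≤ _ := card_le_card fun ωN h => mem_filter.2 ⟨mem_univ _,
            mem_rSet_terminalBlock_of_rSet hsep ha hb hcF hcu h ((hflip false).2 hcO)⟩
    · -- `ω_F ∈ X`: the fibre embeds into `M ⊔ L(N; a, b, u)`; `(M ⊔ R(N; a, b, u)) × {σ ω_F} ⊆ R(G)`
      calc (univ.filter fun ωN : ιN → Bool =>
            Sum.elim ωN ωF ∈ lSet (Sum.elim endsN endsF) a b c).card
          ≤ ((univ.filter fun ωN : ιN → Bool => b ∈ clus endsN ωN true a ∧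
              b ∉ clus endsN ωN false a ∧ u ∈ clus endsN ωN true a ∧ u ∈ clus endsN ωN false a) ∪
              lSet endsN a b u).card := by
            refine card_le_card fun ωN h => ?_
            obtain ⟨hOb, hKb, huO, -, hor⟩ :=
              mem_lSet_terminalBlock hsep ha hb hcF hcu (mem_filter.1 h).2
            rcases hor with ⟨huK, -⟩ | ⟨-, h'⟩
            · exact mem_union_left _ (mem_filter.2 ⟨mem_univ _, hOb, hKb, huO, huK⟩)
            · exact mem_union_right _ h'
        _ ≤ (univ.filter fun ωN : ιN → Bool => b ∈ clus endsN ωN true a ∧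
              b ∉ clus endsN ωN false a ∧ u ∈ clus endsN ωN true a ∧
              u ∈ clus endsN ωN false a).card + (lSet endsN a b u).card := card_union_le _ _
        _ ≤ (univ.filter fun ωN : ιN → Bool => b ∈ clus endsN ωN true a ∧
              b ∉ clus endsN ωN false a ∧ u ∈ clus endsN ωN true a ∧
              u ∈ clus endsN ωN false a).card + (rSet endsN a b u).card := Nat.add_le_add_left h0 _
        _ = ((univ.filter fun ωN : ιN → Bool => b ∈ clus endsN ωN true a ∧
              b ∉ clus endsN ωN false a ∧ u ∈ clus endsN ωN true a ∧ u ∈ clus endsN ωN false a) ∪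
              rSet endsN a b u).card := (card_union_of_disjoint hdisj).symm
        _ ≤ _ := by
            refine card_le_card fun ωN h => mem_filter.2 ⟨mem_univ _, ?_⟩
            rcases mem_union.1 h with h1 | h2
            · obtain ⟨hOb, hKb, -, huK⟩ := (mem_filter.1 h1).2
              exact mem_rSet_terminalBlock_of_M hsep ha hb hcF hcu hOb hKb huK
                ((hflip false).2 hcO) (fun h' => hcK ((hflip true).1 h'))
            · exact mem_rSet_terminalBlock_of_rSet hsep ha hb hcF hcu h2 ((hflip false).2 hcO)
  · -- `c ∉ O_u(F)`: the fibre is empty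
    have h00 : (univ.filter fun ωN : ιN → Bool =>
        Sum.elim ωN ωF ∈ lSet (Sum.elim endsN endsF) a b c) = ∅ :=
      filter_eq_empty_iff.2 fun ωN _ h =>
        hcO (mem_lSet_terminalBlock hsep ha hb hcF hcu h).2.2.2.1
    rw [h00, card_empty]
    exact Nat.zero_le _

/-- **The 1-sum reduction, terminal block** (memo `KCLUSTER-gen73` §1.8 (C), kernel form).  Let
`G = N ∪ F` be glued at the single vertex `u` (every vertex met by edges of both sides is `u`), with
the apex `a` and the terminal `b` met by edges of `F` only if equal to `u`, and the terminal `c`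
interior to `F` (met by an edge of `F`, `c ≠ u`).  Then ANTI₁ for `(N; a, b, u)` implies ANTI₁ for
`(G; a, b, c)`.  No other hypothesis on `N` or `F`. [this work] -/
theorem card_lSet_le_card_rSet_of_terminalBlock (endsN : ιN → Sym2 V) (endsF : ιF → Sym2 V)
    (u a b c : V)
    (hsep : ∀ w i, w ∈ endsN i → ∀ j, w ∈ endsF j → w = u) (ha : ∀ j, a ∈ endsF j → a = u)
    (hb : ∀ j, b ∈ endsF j → b = u) (hcF : ∃ j, c ∈ endsF j) (hcu : c ≠ u)
    (h0 : (lSet endsN a b u).card ≤ (rSet endsN a b u).card) :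
    (lSet (Sum.elim endsN endsF) a b c).card ≤ (rSet (Sum.elim endsN endsF) a b c).card := by
  classical
  calc (lSet (Sum.elim endsN endsF) a b c).card
      = ∑ ωF : ιF → Bool, (univ.filter fun ωN : ιN → Bool =>
          Sum.elim ωN ωF ∈ lSet (Sum.elim endsN endsF) a b c).card := card_eq_sum_card_fibre _
    _ ≤ ∑ ωF : ιF → Bool, (univ.filter fun ωN : ιN → Bool =>
          Sum.elim ωN (fun j => !ωF j) ∈ rSet (Sum.elim endsN endsF) a b c).card :=
        sum_le_sum fun ωF _ => fibre_le_terminalBlock hsep ha hb hcF hcu h0 ωF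
    _ = ∑ ωF : ιF → Bool, (univ.filter fun ωN : ιN → Bool =>
          Sum.elim ωN ωF ∈ rSet (Sum.elim endsN endsF) a b c).card :=
        sum_flip_eq (fun ωF => (univ.filter fun ωN : ιN → Bool =>
          Sum.elim ωN ωF ∈ rSet (Sum.elim endsN endsF) a b c).card)
    _ = (rSet (Sum.elim endsN endsF) a b c).card := (card_eq_sum_card_fibre _).symm

end Sets

end AntipodalR1

end Summit.CriticalPhenomena.PercolationContinuityZ3.Theorems
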